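import Mathlib
import HarnessLib
import Summits.NavierStokesRegularity.NavierStokesRegularity.Theorems.TaylorModelRungThreeReadoutVTubeDerivWin
import Summits.NavierStokesRegularity.NavierStokesRegularity.Theorems.TaylorModelRungThreeReadoutVCrossingWin
import Summits.NavierStokesRegularity.NavierStokesRegularity.Theorems.TaylorModelRungThreeReadoutVDyn
import Summits.NavierStokesRegularity.NavierStokesRegularity.Theorems.TaylorModelRungThreeReadoutVLandBase

/-!
# Line `taylor-model` on crux K1b-DR (stmt-NavierStokesRegularity-23954) — G-side assembly under the WINDOWED v3 certificate,
# part 1: K1b-DR's DYNAMIC block from `ValidVW`, the crux modulo the landing block, and the BASE LANDING inequality read on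
# the level-0 WINDOW box `Z⁰` (ns-tm-g4 g6)

Ports of `…ReadoutVDyn` (`kBlockDynV`, `k1bDR_of_validV_of_land`) and `…ReadoutVLandBase` (`baseCrossing_mem_Y0`,
`baseLanding_ofV`) to `ReadoutsVW` / `ValidVW` (`…VReadoutsWinDefs`).  The one change of substance: the base crossing state is
located in the WINDOWED level-0 box `Z⁰ = [zlo 0, zhi 0]` by `crossing_windowW` (level `0`: the base trajectory's node `S−1` state
is a `NodeStart 0` state, `polyInvariantV`), and (R9w) is read there.

* `kBlockDynVW`, `k1bDR_of_validVW_of_land`;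
* `baseCrossing_mem_Z0W` — the base crossing state lies in `Z⁰` and on the section;
* `baseLanding_ofVW` — the base landing inequality for all tails ((R0) + (R9w)).

MODEL-lattice rung TL-M3 only; nothing here is a statement about the Navier–Stokes equations (K1b-DR is NOT proved here).
-/

noncomputable section

-- the sub-problem namespace repeats the summit name by design (D-0017)
set_option linter.dupNamespace false

namespace Summit.NavierStokesRegularity.NavierStokesRegularity.Theorems.TaylorModelV

open Set
open Literature.Analysis.FluidPDE.TaoCascade Literature.Analysis.FluidPDE.TaoCascade.TaylorChain
open Summit.NavierStokesRegularity.NavierStokesRegularity.Theorems.TaylorModelMajorant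
open Summit.NavierStokesRegularity.NavierStokesRegularity.Theorems.TaylorModelReadout

variable {cd : CertData} {bx : StepBoxes} {rd : RadiiData} {ro : ReadoutData} {rw : WinData} {φ : Flow}

/-! ### The dynamic block and the crux modulo the landing block -/

/-- **K1b-DR's dynamic block from a WINDOWED v3 certificate and a v3 flow package** (crossing time = `tauSel`). [folklore] -/
theorem kBlockDynVW (hV : ValidVW cd bx rd ro rw) (hF : IsFlowPackageV cd bx φ) : KBlockDyn cd φ (tauSel cd φ) := by
  obtain ⟨hS, hSN, ⟨hC, hR⟩, hRO⟩ := hV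
  have hwin : -cd.Kb ≤ cd.Ka := by
    have hKb : 0 ≤ cd.Kb := hS.2.2.2.2.2.2.2.2.2.2.1
    have hKa : 1 ≤ cd.Ka := hS.2.2.2.2.2.2.2.2.2.2.2.1
    linarith
  have hPN := (polyInvariantV hC hR hF).1
  obtain ⟨hE1, hτ⟩ := kBlockE1_crossing_ofVW hSN hC hF hRO hPN
  obtain ⟨hT, hL⟩ := kBlockTubeLip_ofVW hSN hC hF hRO hwin hPN hτ
  exact kBlockDyn_of cd φ _ hE1 hT hL

/-- **K1b-DR modulo the landing block (windowed certificate)**: `ValidVW` plus the landing block `KBlockLand` for the SELECTOR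
flow (at the crossing time `tauSel`) give `DerivativeEnclosureCertificateR`. [folklore] -/
theorem k1bDR_of_validVW_of_land (hV : ValidVW cd bx rd ro rw)
    (hL : KBlockLand cd (fun _ => liftFlow cd (fun x s => flowSel (Qw cd) x s))
      (tauSel cd (fun _ => liftFlow cd (fun x s => flowSel (Qw cd) x s)))) :
    Summit.NavierStokesRegularity.NavierStokesRegularity.Theses.ExactWindowRungThree.DerivativeEnclosureCertificateR := by
  have hF : IsFlowPackageV cd bx (fun _ => liftFlow cd (fun x s => flowSel (Qw cd) x s)) :=
    isFlowPackageV_of_core hV.2.1 hV.2.2.1.1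
  exact k1bDR_of_blocks cd hV.1 hV.2.1 _ _ (kBlockDynVW hV hF) hL

/-! ### The base landing on the level-0 window box -/

/-- **The base crossing state** `φ(x j 0)(tauSel)` lies in the WINDOWED level-0 box `Z⁰` and on the section. [folklore] -/
theorem baseCrossing_mem_Z0W (hSN : cd.StageNumerics) (hC : ChainVCore cd bx) (hR : ChainVRadii cd bx rd)
    (hF : IsFlowPackageV cd bx φ) (hRO : ReadoutsVW cd bx rd ro rw) {j : ℕ} (hj : j ≤ cd.N₀) :
    InBox cd (rw.zlo 0 j) (rw.zhi 0 j) (stAt φ j (cd.x j 0) (tauSel cd φ j (cd.x j 0))) ∧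
      cd.σf j (stAt φ j (cd.x j 0) (tauSel cd φ j (cd.x j 0))) = cd.lev j := by
  have hS : 1 ≤ cd.S j := (hC j hj).1
  have hs : cd.S j - 1 < cd.S j := Nat.sub_lt hS Nat.one_pos
  obtain ⟨-, hx0, -⟩ := hRO j hj
  obtain ⟨hq, hqN⟩ := (polyInvariantV hC hR hF).1 j hj _ hx0
  obtain ⟨-, -, h3, -, -, -⟩ := crossing_factsVW hSN hC hF hRO hj hq hqN
  have hn0 : InBox cd (bx.hlo 0 j (cd.S j - 1)) (bx.hhi 0 j (cd.S j - 1)) (stAt φ j (cd.x j 0) (cd.Tn j (cd.S j - 1))) :=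
    ((polyInvariantV hC hR hF).2 j hj hx0 _ hs.le).2
  obtain ⟨-, -, hZ⟩ := crossing_windowW hSN hC hF hRO hj hq hqN 0 (by simpa [hullLevel] using hn0)
  exact ⟨hZ, h3⟩

/-- **BASE LANDING (first half of `KBlockLand`) under the WINDOWED certificate**: the base point is in the polytope and its
landing read-out at the crossing satisfies K1b-DR's inequality with allowance `β` ((R0) + (R9w) on `Z⁰`). [folklore] -/
theorem baseLanding_ofVW (hSN : cd.StageNumerics) (hC : ChainVCore cd bx) (hR : ChainVRadii cd bx rd)
    (hF : IsFlowPackageV cd bx φ) (hRO : ReadoutsVW cd bx rd ro rw) {j : ℕ} (hj : j ≤ cd.N₀) :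
    InPoly cd j (cd.x j 0) ∧ ∀ v : Fin 4 → ℝ, TailOK cd v → ∀ l,
      |cd.ℓ (cd.nx j) l (cd.land j (stAt φ j (cd.x j 0) (tauSel cd φ j (cd.x j 0))) v) - cd.ctr (cd.nx j) l| +
        cd.β j l ≤ cd.rad (cd.nx j) l - cd.s (cd.nx j) l := by
  obtain ⟨-, hx0, -, -, -, -, -, -, -, -, -, -, -, -, -, hR9, -⟩ := hRO j hj
  obtain ⟨hZ, hσ⟩ := baseCrossing_mem_Z0W hSN hC hR hF hRO hj
  exact ⟨hx0, fun v hv l => hR9 _ hZ hσ v hv l⟩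

end Summit.NavierStokesRegularity.NavierStokesRegularity.Theorems.TaylorModelV

end
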